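import Mathlib

/-!
# The 24 rotations of the cube: skc's character table, the column identity (COL) and Schur
# orthogonality (SCHUR) of the vector irrep, as kernel-checked finite facts
(cap g7, cell `ns-blowup`, 2026-08-26)

HONEST FRAMING (human ruling D-0035): nothing here is a claim about Navier–Stokes blow-up.
WHAT THIS IS NOT: not NS evidence. MODEL/linear bookkeeping — the CONCRETE half of
`SymmetryClassProjectors` for the symmetry group actually used by the cell's class-restricted
certificates (X0 PAIR W-1, D2-3L-X0, O3′/O3″, P-ONSET13-3L).

The engines (`skc.py` 7a8f74d2e0b53992 `find_symmetries` / `rot_class` / `CHAR` / `ClassBasis`;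
`d2_cert.py` v1.8 58fa176b0c17cc92 `OneCopyBasis`) realise the 24-element symmetry group `Γ` of
`abc(1,1,1)` as affine maps `x ↦ Mx + t` whose linear parts `M` are the 24 PROPER SIGNED
PERMUTATION MATRICES (`det M = +1`; the rotation group `O ≅ S₄` of the cube = `SO(3, ℤ)`), classify
`M` by `rot_class` (trace `3 / 0 / 1 / −1 & diagonal / −1 & not diagonal` ↦
`e / C3 / C4 / C2f / C2e`), and use the character table `CHAR` (rows I–V) to build the class
projectors `(d_c/24) ∑_g χ_c(g) ρ(g)` and, for the 3-dimensional classes, the one-copy projector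
`(3/24) ∑_g r(g)₁₁ ρ(g)` with `r(g) = M_g` (IV) or `sgn(g)·M_g` (V). This file lists the 24 matrices
(`cubeRotations`, in `rot_class` order), transcribes `rot_class` (`rotClass`) and `CHAR`
(`charTable`) VERBATIM, and proves by `decide` / case evaluation:

* group facts: `card = 24`, class counts `{e:1, C3:8, C2f:3, C4:6, C2e:6}` (skc's assert), `1 ∈`,
  closure under products and transposes, `Mᵀ M = 1` (so `r(g⁻¹) = r(g)ᵀ`), `det M = 1`;
* (COL) `∑_c d_c χ_c(M) = 24·[M = 1]` for every `M` (with `trace M = 3 ↔ M = 1`) — the hypothesis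
  `hcol` of `SymmetryClassProjectors.sum_classProj_eq_one` after division by 24;
* (ROW) `∑_M χ_c(M) χ_{c'}(M) = 24·[c = c']` (skc's `exact_group_checks` (c) «character norm 1», and
  more), `χ_II` multiplicative, `χ_IV(M) = trace M` and `χ_V = χ_II · χ_IV` (d2_cert's OneCopyBasis
  «irrep identification» asserts: the vector representation realises class IV, `sgn ⊗ vector`
  class V);
* (SCHUR) `∑_M (Mᵀ)_{βα} M_{εγ} = 8·[α = ε ∧ β = γ]`, and the same with the sign twist — the
  hypothesis `hS` of `SymmetryClassProjectors.matrixUnit_mul` (`κ = 3/24 = 1/8`) for classes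
  IV and V; the normalised `ℚ`-forms `col_identity_rat` / `schur_vector_rat` are literally
  (COL)/(SCHUR).

What stays the instance's reading (D2-CHAIN-MAP S1-type engine identity): skc's `G` has exactly
these 24 linear parts, each once, `g ↦ M_g` is an isomorphism `Γ ≅ O`, and skc's `ρ` is a
representation of `Γ` on the coefficient space. Mathlib only; three transparent data definitions
(the list, `rotClass`, `charTable`); std axioms. Nothing here is specific to Navier–Stokes.
-/

namespace Summit.NavierStokesRegularity.FluidComputer.CubeRotationOrthogonality

open Matrix

/-- The 24 proper signed permutation matrices (`SO(3, ℤ)`, the rotation group `O` of the cube = the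
linear parts of skc's `find_symmetries()`), in `rot_class` order: `e`; `C4` ×6 (trace 1); `C3` ×8
(trace 0); `C2f` ×3 (trace −1, diagonal); `C2e` ×6 (trace −1, off-diagonal). -/
def cubeRotations : Finset (Matrix (Fin 3) (Fin 3) ℤ) :=
  { !![1, 0, 0; 0, 1, 0; 0, 0, 1],
    !![1, 0, 0; 0, 0, 1; 0, -1, 0], !![1, 0, 0; 0, 0, -1; 0, 1, 0],
    !![0, 1, 0; -1, 0, 0; 0, 0, 1], !![0, 0, 1; 0, 1, 0; -1, 0, 0],
    !![0, 0, -1; 0, 1, 0; 1, 0, 0], !![0, -1, 0; 1, 0, 0; 0, 0, 1],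
    !![0, 1, 0; 0, 0, 1; 1, 0, 0], !![0, 1, 0; 0, 0, -1; -1, 0, 0],
    !![0, 0, 1; 1, 0, 0; 0, 1, 0], !![0, 0, 1; -1, 0, 0; 0, -1, 0],
    !![0, 0, -1; 1, 0, 0; 0, -1, 0], !![0, 0, -1; -1, 0, 0; 0, 1, 0],
    !![0, -1, 0; 0, 0, 1; -1, 0, 0], !![0, -1, 0; 0, 0, -1; 1, 0, 0],
    !![1, 0, 0; 0, -1, 0; 0, 0, -1], !![-1, 0, 0; 0, 1, 0; 0, 0, -1],
    !![-1, 0, 0; 0, -1, 0; 0, 0, 1],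
    !![0, 1, 0; 1, 0, 0; 0, 0, -1], !![0, 0, 1; 0, -1, 0; 1, 0, 0],
    !![0, 0, -1; 0, -1, 0; -1, 0, 0], !![0, -1, 0; -1, 0, 0; 0, 0, -1],
    !![-1, 0, 0; 0, 0, 1; 0, 1, 0], !![-1, 0, 0; 0, 0, -1; 0, -1, 0] }

/-- skc's `rot_class(M)` as an index `0 … 4` in the column order of `CHAR`:
`0 = e` (trace 3), `1 = C3` (trace 0), `2 = C2f` (trace −1, diagonal), `3 = C4` (trace 1),
`4 = C2e` (trace −1, not diagonal). -/
def rotClass (M : Matrix (Fin 3) (Fin 3) ℤ) : Fin 5 :=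
  if M.trace = 3 then 0 else if M.trace = 0 then 1 else if M.trace = 1 then 3
  else if ∀ i j : Fin 3, i ≠ j → M i j = 0 then 2 else 4

/-- skc's `CHAR` table VERBATIM (`skc.py` l.166–167): rows `I, II, III, IV, V` (indices `0 … 4`),
columns `e, C3, C2f, C4, C2e` (indices `0 … 4`); column `0` holds the dimensions
`d_c = 1, 1, 2, 3, 3`. -/
def charTable : Fin 5 → Fin 5 → ℤ :=
  ![![1, 1, 1, 1, 1], ![1, 1, 1, -1, -1], ![2, -1, 2, 0, 0], ![3, 0, -1, 1, -1], ![3, 0, -1, -1, 1]]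

/-! ### §1 Group facts (skc's `exact_group_checks` (b) on the linear parts) -/

/-- `|O| = 24`. -/
theorem card_cubeRotations : cubeRotations.card = 24 := by decide

/-- Class counts `{e: 1, C3: 8, C2f: 3, C4: 6, C2e: 6}` (skc's `ClassBasis.__init__` assert). -/
theorem card_filter_rotClass :
    (cubeRotations.filter fun M => rotClass M = 0).card = 1 ∧
    (cubeRotations.filter fun M => rotClass M = 1).card = 8 ∧
    (cubeRotations.filter fun M => rotClass M = 2).card = 3 ∧
    (cubeRotations.filter fun M => rotClass M = 3).card = 6 ∧
    (cubeRotations.filter fun M => rotClass M = 4).card = 6 := by decide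

/-- The identity belongs to the list, and `trace M = 3` singles it out (`rot_class = e ↔ M = 1`). -/
theorem one_mem_cubeRotations : (1 : Matrix (Fin 3) (Fin 3) ℤ) ∈ cubeRotations := by decide

/-- On `O`, `trace M = 3 ↔ M = 1` (skc's `rot_class` returns `e` exactly at the identity). -/
theorem trace_eq_three_iff_of_mem : ∀ M ∈ cubeRotations, M.trace = 3 ↔ M = 1 := by decide

/-- Orthogonality `Mᵀ M = 1` (so the inverse of each element is its transpose: `r(g⁻¹) = r(g)ᵀ`). -/
theorem transpose_mul_self_of_mem : ∀ M ∈ cubeRotations, Mᵀ * M = 1 := by decide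

/-- Orthogonality on the other side: `M Mᵀ = 1`. -/
theorem mul_transpose_self_of_mem : ∀ M ∈ cubeRotations, M * Mᵀ = 1 := by decide

/-- Properness `det M = +1` (d2_cert `OneCopyBasis` assert «expected proper rotations»). -/
theorem det_of_mem : ∀ M ∈ cubeRotations, M.det = 1 := by
  intro M hM
  simp only [cubeRotations, Finset.mem_insert, Finset.mem_singleton] at hM
  rcases hM with rfl | rfl | rfl | rfl | rfl | rfl | rfl | rfl | rfl | rfl | rfl | rfl | rfl | rfl |
    rfl | rfl | rfl | rfl | rfl | rfl | rfl | rfl | rfl | rfl <;>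
  simp [Matrix.det_fin_three]

/-- Closure under transposition (= inversion). -/
theorem transpose_mem_of_mem : ∀ M ∈ cubeRotations, Mᵀ ∈ cubeRotations := by decide

/-- Closure under products: the 24 matrices form a group (`skc`: «closure table complete»). -/
theorem mul_mem_of_mem : ∀ A ∈ cubeRotations, ∀ B ∈ cubeRotations, A * B ∈ cubeRotations := by
  decide +kernel

/-! ### §2 The character table: (COL), (ROW), and the identification of classes IV / V -/

/-- **(COL)** `∑_c d_c χ_c(M) = 24·[M = 1]` for every rotation `M` (column orthogonality of `CHAR`
at the identity column; `d_c = charTable c 0`). Divided by `24` this is the hypothesis `hcol` of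
`SymmetryClassProjectors.sum_classProj_eq_one` (see `col_identity_rat`). -/
theorem col_identity : ∀ M ∈ cubeRotations,
    ∑ c : Fin 5, charTable c 0 * charTable c (rotClass M) = if M = 1 then 24 else 0 := by decide

/-- **(ROW)** `∑_M χ_c(M) χ_{c'}(M) = 24·[c = c']` (row orthogonality; `c = c'` is skc's
`exact_group_checks` (c) «character norm 1»). -/
theorem row_orthogonality : ∀ c c' : Fin 5,
    ∑ M ∈ cubeRotations, charTable c (rotClass M) * charTable c' (rotClass M) =
      if c = c' then 24 else 0 := by decide

/-- `χ_II` (the sign character, row `1`) is multiplicative on `O` (skc's check (c) for the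
one-dimensional classes; `χ_I ≡ 1` trivially). -/
theorem charII_mul : ∀ A ∈ cubeRotations, ∀ B ∈ cubeRotations,
    charTable 1 (rotClass (A * B)) = charTable 1 (rotClass A) * charTable 1 (rotClass B) := by
  decide +kernel

/-- `χ_II(M) = ∏_p ∑_q M_{pq}` (the product of the signs of the signed permutation). -/
theorem charII_eq_prod_sum : ∀ M ∈ cubeRotations,
    charTable 1 (rotClass M) = ∏ p : Fin 3, ∑ q : Fin 3, M p q := by decide

/-- **Class IV is the vector representation**: `χ_IV(M) = trace M` (d2_cert `OneCopyBasis`: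
«rho(g) = M realises CHAR[IV], checked on all 24 elements»). -/
theorem charIV_eq_trace : ∀ M ∈ cubeRotations, charTable 3 (rotClass M) = M.trace := by decide

/-- **Class V is `sgn ⊗ vector`**: `χ_V(M) = χ_II(M) · trace M` (d2_cert `OneCopyBasis`:
«rho(g) = sgn(g)*M realises CHAR[V]»). -/
theorem charV_eq_charII_mul_trace : ∀ M ∈ cubeRotations,
    charTable 4 (rotClass M) = charTable 1 (rotClass M) * M.trace := by decide

/-! ### §3 (SCHUR) for the vector irrep and its sign twist -/

/-- **(SCHUR), class IV**: `∑_M (Mᵀ)_{βα} M_{εγ} = 8·[α = ε ∧ β = γ]` — Schur orthogonality of the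
matrix coefficients of the vector irrep in exactly the index pattern of
`SymmetryClassProjectors.matrixUnit_mul`'s hypothesis `hS` (`r(g⁻¹) = M_gᵀ`, `|O|/3 = 8`). -/
theorem schur_vector : ∀ α β γ ε : Fin 3,
    ∑ M ∈ cubeRotations, Mᵀ β α * M ε γ = if α = ε ∧ β = γ then 8 else 0 := by decide

/-- **(SCHUR), class V**: the same sums for `r(g) = χ_II(g)·M_g` (the twist squares away). -/
theorem schur_signVector : ∀ α β γ ε : Fin 3,
    ∑ M ∈ cubeRotations, (charTable 1 (rotClass M) * Mᵀ β α) * (charTable 1 (rotClass M) * M ε γ) =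
      if α = ε ∧ β = γ then 8 else 0 := by decide

/-! ### §4 Normalised `ℚ`-forms: literally (COL) and (SCHUR) of `SymmetryClassProjectors` -/

/-- (COL) normalised: `∑_c (d_c/24) χ_c(M) = [M = 1]`. -/
theorem col_identity_rat : ∀ M ∈ cubeRotations,
    ∑ c : Fin 5, ((charTable c 0 : ℚ) / 24) * (charTable c (rotClass M) : ℚ) =
      if M = 1 then 1 else 0 := by
  intro M hM
  have h := col_identity M hM
  have hcast : ∑ c : Fin 5, ((charTable c 0 : ℚ) / 24) * (charTable c (rotClass M) : ℚ) =
      ((∑ c : Fin 5, charTable c 0 * charTable c (rotClass M) : ℤ) : ℚ) / 24 := by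
    push_cast
    rw [Finset.sum_div]
    exact Finset.sum_congr rfl fun c _ => by ring
  rw [hcast, h]
  split_ifs <;> norm_num

/-- (SCHUR) normalised, class IV: `(1/8) ∑_M (Mᵀ)_{βα} M_{εγ} = [α = ε ∧ β = γ]`. -/
theorem schur_vector_rat : ∀ α β γ ε : Fin 3,
    (1 / 8 : ℚ) * ∑ M ∈ cubeRotations, ((Mᵀ β α : ℤ) : ℚ) * ((M ε γ : ℤ) : ℚ) =
      if α = ε ∧ β = γ then 1 else 0 := by
  intro α β γ ε
  have h := schur_vector α β γ ε
  have hcast : ∑ M ∈ cubeRotations, ((Mᵀ β α : ℤ) : ℚ) * ((M ε γ : ℤ) : ℚ) =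
      ((∑ M ∈ cubeRotations, Mᵀ β α * M ε γ : ℤ) : ℚ) := by push_cast; rfl
  rw [hcast, h]
  split_ifs <;> norm_num

/-- (SCHUR) normalised, class V. -/
theorem schur_signVector_rat : ∀ α β γ ε : Fin 3,
    (1 / 8 : ℚ) * ∑ M ∈ cubeRotations, ((charTable 1 (rotClass M) * Mᵀ β α : ℤ) : ℚ) *
      ((charTable 1 (rotClass M) * M ε γ : ℤ) : ℚ) = if α = ε ∧ β = γ then 1 else 0 := by
  intro α β γ ε
  have h := schur_signVector α β γ ε
  have hcast : ∑ M ∈ cubeRotations, ((charTable 1 (rotClass M) * Mᵀ β α : ℤ) : ℚ) *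
      ((charTable 1 (rotClass M) * M ε γ : ℤ) : ℚ) =
      ((∑ M ∈ cubeRotations, (charTable 1 (rotClass M) * Mᵀ β α) *
        (charTable 1 (rotClass M) * M ε γ) : ℤ) : ℚ) := by push_cast; rfl
  rw [hcast, h]
  split_ifs <;> norm_num

end Summit.NavierStokesRegularity.FluidComputer.CubeRotationOrthogonality
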